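import Summits.ResolutionOfSingularities.ResolutionOfSingularities.Theorems.FrobeniusClosingPatchingRelPerfectConeCubeLevelTwoIdeals
import Summits.ResolutionOfSingularities.ResolutionOfSingularities.Theorems.FrobeniusClosingPatchingRelPerfectChartStrictHypersurface
import Summits.ResolutionOfSingularities.ResolutionOfSingularities.Theorems.FrobeniusClosingPatchingRelPerfectConeDepthTwoLevelTwo
import Summits.ResolutionOfSingularities.ResolutionOfSingularities.Theorems.FrobeniusClosingPatchingRelPerfectLetterTower
import Summits.ResolutionOfSingularities.ResolutionOfSingularities.Theorems.FrobeniusClosingPatchingRelPerfectPairSwap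
import Summits.ResolutionOfSingularities.ResolutionOfSingularities.Theorems.FrobeniusClosingPatchingRelPerfectConeTiltCharts
import Summits.ResolutionOfSingularities.ResolutionOfSingularities.Theorems.FrobeniusClosingPatchingRelPerfectConeMemberLevelThree
import HarnessLib

/-!
# Crux `PatchingRelPerfect` (stmt-ResolutionOfSingularities-16161), chain w52 — the
# CONTACT-MIGRATION member `I = (x₀x₁ + x₂² + x₃³) + 𝔪⁴`: level two (the vertex blow-up),
# regularity

[OURS · L1 W5.2 · rung] PLAN-A2-certificate.md addendum 5 steps (2)–(3).  Setting of
`…ConeCubeLevelTwoIdeals`: `A` a regular domain, `c = (t, v₀, v₁, v₂)` quasi-regular with `A/(c)`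
a regular domain, `A/(t)` and `A/(t, F)` domains (`F = v₀v₁ + v₂²`), `v_k ∉ (t)`, `v_k ∉ (t, F)`,
`F ∉ (t)`, and the cone `V(t, F)` regular off its vertex.  On the `v_k`-chart `C_k` of `Bl_{(c)}`
(`w`, `u' = e'₀`, `G = e'₁e'₂ + e'₃²`, `c = u' + w G` the strict transform of `V(F + t)`) we
DISCHARGE the hypotheses `H''(C_k; c, w, G)` of the letter tower (`…LetterTower`):

* `(c, w) = (w, u')`, `(c, G) = (u', G)` as ideals; the pairs `(c, w)`, `(c, G)` are weakly / quasi-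
  regular (chart family, `…ChartStrictExceptional`, swaps and perturbations of `…PairSwap`);
* `C_k/(c, w) ≅ C_k/(w, u')` is a regular domain; `C_k/(c, G) = C_k/(u', G)` is regular
  (`isRegularRing_quot_span_u'_G`, r2c) and a domain (brick 7 `strictHyp_isDomain_quot_pair`);
* `G ∉ (c, w)` (`mk_G_mem_nonZeroDivisors`), `w ∉ (c, G)` (brick 7).

Hence `isRegular_of_isBlowup_cubePi_succ`: every blowing up of `Spec C_k` along
`Π C_k = (w⁵) · ∏_{s<5} (c, L₀⋯L_s)`, letters `(w, G, w, w, G)`, is regular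
(`isRegular_of_isBlowup_letterTower 5`); `isRegular_of_isBlowup_cubePi_zero` (the `t`-chart,
Cartier); and the LEVEL-TWO ASSEMBLY `isRegular_of_isBlowup_cubePi_mul_span`: **every blowing up
of `Spec A` along `Π · (t, v₀, v₁, v₂)` is regular**.  Nothing here is a statement of the manuscript
under review.

## References

* The Stacks Project, Tags 080A, 080B, 0804, 0BIQ. [StacksProject]
* Q. Liu, *Algebraic Geometry and Arithmetic Curves*, OUP 2002, Thm. 8.1.19 (a). [Liu2002]
* H. Matsumura, *Commutative Ring Theory*, CUP 1986, Thm. 16.2. [Matsumura1987]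
-/

-- `Summit.<Summit>.<Sub>.Theorems` with `Sub = Summit` (single-conjunct summit, D-0017)
set_option linter.dupNamespace false

noncomputable section

open CategoryTheory CategoryTheory.Limits AlgebraicGeometry Literature.AlgebraicGeometry.Resolution
open IsLocalRing

namespace Summit.ResolutionOfSingularities.ResolutionOfSingularities.Theorems

namespace ConeRung

universe u

/-! ## Generic pair algebra -/

section Generic

variable {X : Type u} [CommRing X]

/-- `(b + a m, a) = (a, b)`. [folklore] -/
theorem span_pair_add_mul_right (a b m : X) : Ideal.span {b + a * m, a} = Ideal.span {a, b} := by
  rw [Ideal.span_pair_comm]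
  exact span_pair_add_mul a b m

/-- `(b + m a, a) = (b, a)`. [folklore] -/
theorem span_pair_add_mul_left (a b m : X) : Ideal.span {b + m * a, a} = Ideal.span {b, a} := by
  rw [mul_comm, span_pair_add_mul_right, Ideal.span_pair_comm]

/-- `[a, b]` weakly regular ⇒ `[a, b + m a]` weakly regular. [cite: Matsumura1987, Thm. 16.2 (i)] -/
theorem isWeaklyRegular_pair_of_add_mul' (a b m : X)
    (h : RingTheory.Sequence.IsWeaklyRegular X (List.ofFn (Fin.cons a fun _ : Fin 1 => b))) :
    RingTheory.Sequence.IsWeaklyRegular X (List.ofFn (Fin.cons a fun _ : Fin 1 => b + m * a)) := by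
  rw [mul_comm]
  exact isWeaklyRegular_pair_of_add_mul a b m h

end Generic

/-! ## Level two over a regular base: `H''(C_k; c, w, G)` on the `v_k`-charts -/

section LevelTwoRegular

variable {A : Type u} [CommRing A] (t : A) (v : Fin 3 → A)
  (hc : IsQuasiRegular (Fin.cons t v : Fin 4 → A))

local notation3 "cc" => (Fin.cons t v : Fin 4 → A)
local notation3 "F" => v 0 * v 1 + v 2 ^ 2
/-- the five companion factors `M₂₀ M₀₂ M₁₀ M₁₁ M₁₂` of the member at the vertex chart -/
local notation3 "cubePi" =>
  (Ideal.span {v 0 * v 1 + v 2 ^ 2 + t} ⊔ Ideal.span {t} ^ 2) *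
    (Ideal.span {v 0 * v 1 + v 2 ^ 2 + t} ⊔ Ideal.span {t, v 0, v 1, v 2} ^ 2) *
    (Ideal.span {v 0 * v 1 + v 2 ^ 2 + t} ⊔ Ideal.span {t}) *
    (Ideal.span {v 0 * v 1 + v 2 ^ 2 + t} ⊔ Ideal.span {t} * Ideal.span {t, v 0, v 1, v 2}) *
    (Ideal.span {v 0 * v 1 + v 2 ^ 2 + t} ⊔ Ideal.span {t} * Ideal.span {t, v 0, v 1, v 2} ^ 2)
/-- the `v_k`-chart (`j = k + 1`) and its data -/
local notation3 "C[" k "]" => chartRing (Fin.cons t v : Fin 4 → A) (Fin.succ k)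
local notation3 "w[" k "]" => chartBase cc (Fin.succ k) (cc (Fin.succ k))
local notation3 "u'[" k "]" => chartGen cc (Fin.succ k) 0
local notation3 "G[" k "]" => chartGen cc (Fin.succ k) 1 * chartGen cc (Fin.succ k) 2 +
  chartGen cc (Fin.succ k) 3 ^ 2
/-- the strict transform `c = u' + w G` of `V(F + t)` on the `v_k`-chart -/
local notation3 "c[" k "]" => chartGen cc (Fin.succ k) 0 +
  chartBase cc (Fin.succ k) (cc (Fin.succ k)) *
    (chartGen cc (Fin.succ k) 1 * chartGen cc (Fin.succ k) 2 + chartGen cc (Fin.succ k) 3 ^ 2)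
/-- the plane family `(w, u')` -/
local notation3 "c₃[" k "]" => (Fin.cons (chartBase cc (Fin.succ k) (cc (Fin.succ k)))
  (fun _ : Fin 1 => chartGen cc (Fin.succ k) 0) : Fin 2 → chartRing cc (Fin.succ k))

/-! ### The two centres as ideals -/

/-- `(c, w) = (w, u')`. [folklore] -/
theorem span_c_w (k : Fin 3) : Ideal.span {c[k], w[k]} = Ideal.span {w[k], u'[k]} :=
  span_pair_add_mul_right _ _ _

/-- `(c, G) = (u', G)`. [folklore] -/
theorem span_c_G (k : Fin 3) : Ideal.span {c[k], G[k]} = Ideal.span {u'[k], G[k]} :=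
  span_pair_add_mul_left _ _ _

/-- `(w, u') = (w) + (u')` is the ideal of the plane family. [folklore] -/
theorem span_range_c₃_eq_sup (k : Fin 3) :
    Ideal.span (Set.range c₃[k]) = Ideal.span {w[k]} ⊔ Ideal.span {u'[k]} := by
  rw [span_range_cthree w[k] u'[k], Ideal.span_insert]

include hc in
/-- `C_k ⧸ (c, w)` is a domain (`≅ C_k ⧸ (w, u')`, a polynomial ring over `A/(c)`).
[cite: StacksProject, Tag 0BIQ] -/
theorem isDomain_quot_span_c_w (k : Fin 3) [IsDomain (A ⧸ Ideal.span (Set.range cc))] :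
    IsDomain (C[k] ⧸ Ideal.span {c[k], w[k]}) := by
  haveI := strictHyp_isDomain_quot_sup t v k hc
  exact MulEquiv.isDomain (C[k] ⧸ (Ideal.span {w[k]} ⊔ Ideal.span {u'[k]}))
    (Ideal.quotEquivOfEq ((span_c_w t v k).trans (Ideal.span_insert _ _))).toMulEquiv

include hc in
/-- `C_k ⧸ (c, w)` is a regular ring. [cite: StacksProject, Tag 0BIQ] -/
theorem isRegularRing_quot_span_c_w (k : Fin 3) [IsRegularRing (A ⧸ Ideal.span (Set.range cc))] :
    IsRegularRing (C[k] ⧸ Ideal.span {c[k], w[k]}) := by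
  haveI := isRegularRing_quot_cthree t v hc k
  exact IsRegularRing.of_ringEquiv (R := C[k] ⧸ Ideal.span (Set.range c₃[k]))
    (Ideal.quotEquivOfEq ((span_range_cthree w[k] u'[k]).trans (span_c_w t v k).symm))

include hc in
/-- **`G ∉ (w) + (u')`** (`Ḡ ≠ 0` in the domain `C_k/(w, u')`). [folklore] -/
theorem G_notMem_sup (k : Fin 3) [IsDomain (A ⧸ Ideal.span (Set.range cc))] :
    G[k] ∉ Ideal.span {w[k]} ⊔ Ideal.span {u'[k]} := by
  haveI := strictHyp_isDomain_quot_sup t v k hc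
  haveI : IsDomain (C[k] ⧸ Ideal.span (Set.range c₃[k])) :=
    MulEquiv.isDomain (C[k] ⧸ (Ideal.span {w[k]} ⊔ Ideal.span {u'[k]}))
      (Ideal.quotEquivOfEq (span_range_c₃_eq_sup t v k)).toMulEquiv
  intro hG
  rw [← span_range_c₃_eq_sup t v k] at hG
  exact nonZeroDivisors.ne_zero (mk_G_mem_nonZeroDivisors t v hc k)
    (Ideal.Quotient.eq_zero_iff_mem.mpr hG)

include hc in
/-- `G ∉ (c, w)`. [folklore] -/
theorem G_notMem_span_c_w (k : Fin 3) [IsDomain (A ⧸ Ideal.span (Set.range cc))] :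
    G[k] ∉ Ideal.span {c[k], w[k]} := by
  rw [span_c_w t v k, Ideal.span_insert]
  exact G_notMem_sup t v hc k

/-! ### The pairs `(c, w)` and `(c, G)` -/

include hc in
/-- `(w, c)` is weakly regular: the chart family `(w, u')` perturbed by `w G`.
[cite: Matsumura1987, Thm. 16.2 (i)] -/
theorem isWeaklyRegular_w_c (k : Fin 3) :
    RingTheory.Sequence.IsWeaklyRegular C[k] (List.ofFn (Fin.cons w[k] fun _ : Fin 1 => c[k])) := by
  have h1 : RingTheory.Sequence.IsWeaklyRegular C[k]
      (List.ofFn (Fin.cons w[k] fun _ : Fin 1 => u'[k])) :=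
    CoreRungTower.isWeaklyRegular_chartFamily cc (Fin.succ k)
      (fun _ : Fin 1 => (⟨0, (Fin.succ_ne_zero k).symm⟩ : {l : Fin 4 // l ≠ Fin.succ k})) hc
      (Function.injective_of_subsingleton _)
  exact isWeaklyRegular_pair_of_add_mul _ _ _ h1

include hc in
/-- `c ∉ (w)` (`c ≡ u' (mod w)` and `u' ∉ (w)`). [cite: StacksProject, Tag 0BIQ] -/
theorem c_notMem_span_w (k : Fin 3) [Nontrivial (A ⧸ Ideal.span (Set.range cc))] :
    c[k] ∉ Ideal.span {w[k]} := by
  intro h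
  apply strictExc_chartGen_notMem_span t v k hc
  have e : u'[k] = c[k] - w[k] * G[k] := by ring
  rw [e]
  exact Ideal.sub_mem _ h (Ideal.mul_mem_right _ _ (Ideal.mem_span_singleton_self _))

variable [IsDomain A]

include hc in
/-- `c` is a non-zero-divisor of the domain `C_k`. [folklore] -/
theorem c_mem_nonZeroDivisors (k : Fin 3) [Nontrivial (A ⧸ Ideal.span (Set.range cc))]
    (hvk : v k ∉ Ideal.span {t}) : c[k] ∈ nonZeroDivisors C[k] := by
  haveI : IsDomain C[k] := strictExc_isDomain_chart t v k (strictExc_ne_zero t v k hvk)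
  haveI : NoZeroDivisors C[k] := IsDomain.to_noZeroDivisors (chartRing cc (Fin.succ k))
  exact mem_nonZeroDivisors_of_ne_zero fun h0 =>
    c_notMem_span_w t v hc k (by rw [h0]; exact Ideal.zero_mem _)

include hc in
/-- `G` is a non-zero-divisor of the domain `C_k`. [folklore] -/
theorem G_mem_nonZeroDivisors (k : Fin 3) [IsDomain (A ⧸ Ideal.span (Set.range cc))]
    (hvk : v k ∉ Ideal.span {t}) : G[k] ∈ nonZeroDivisors C[k] := by
  haveI : IsDomain C[k] := strictExc_isDomain_chart t v k (strictExc_ne_zero t v k hvk)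
  haveI : NoZeroDivisors C[k] := IsDomain.to_noZeroDivisors (chartRing cc (Fin.succ k))
  exact mem_nonZeroDivisors_of_ne_zero fun h0 =>
    G_notMem_sup t v hc k (by rw [h0]; exact Ideal.zero_mem _)

include hc in
/-- `u'` is a non-zero-divisor of the domain `C_k`. [folklore] -/
theorem u'_mem_nonZeroDivisors (k : Fin 3) [Nontrivial (A ⧸ Ideal.span (Set.range cc))]
    (hvk : v k ∉ Ideal.span {t}) : u'[k] ∈ nonZeroDivisors C[k] := by
  haveI : IsDomain C[k] := strictExc_isDomain_chart t v k (strictExc_ne_zero t v k hvk)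
  haveI : NoZeroDivisors C[k] := IsDomain.to_noZeroDivisors (chartRing cc (Fin.succ k))
  exact mem_nonZeroDivisors_of_ne_zero fun h0 =>
    strictExc_chartGen_notMem_span t v k hc (by rw [h0]; exact Ideal.zero_mem _)

omit [IsDomain A] in
/-- `w` is a non-zero-divisor of `C_k`. [cite: StacksProject, Tag 0804] -/
theorem w_mem_nonZeroDivisors (k : Fin 3) : w[k] ∈ nonZeroDivisors C[k] :=
  reesChartBase_mem_nonZeroDivisors (cc (Fin.succ k))
    (Ideal.mem_span_range_self (f := cc) (x := Fin.succ k))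

include hc in
/-- **`(c, w)` is weakly regular.** [cite: Matsumura1987, Thm. 16.2 (i)] -/
theorem isWeaklyRegular_c_w (k : Fin 3) [Nontrivial (A ⧸ Ideal.span (Set.range cc))]
    (hvk : v k ∉ Ideal.span {t}) :
    RingTheory.Sequence.IsWeaklyRegular C[k] (List.ofFn (Fin.cons c[k] fun _ : Fin 1 => w[k])) :=
  isWeaklyRegular_pair_swap _ _ (w_mem_nonZeroDivisors t v k) (c_mem_nonZeroDivisors t v hc k hvk)
    (isWeaklyRegular_w_c t v hc k)

include hc in
/-- **`(c, G)` is weakly regular**: `(u', G)` is (brick 2, `F ∉ (t)`), swap to `(G, u')`, perturb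
to `(G, u' + w G) = (G, c)`, swap. [cite: Matsumura1987, Thm. 16.2 (i)] -/
theorem isWeaklyRegular_c_G (k : Fin 3) [IsDomain (A ⧸ Ideal.span (Set.range cc))]
    [IsDomain (A ⧸ Ideal.span {t})] (hvk : v k ∉ Ideal.span {t}) (hFt : F ∉ Ideal.span {t}) :
    RingTheory.Sequence.IsWeaklyRegular C[k] (List.ofFn (Fin.cons c[k] fun _ : Fin 1 => G[k])) := by
  have h1 : RingTheory.Sequence.IsWeaklyRegular C[k]
      (List.ofFn (Fin.cons u'[k] fun _ : Fin 1 => G[k])) :=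
    strictExc_isWeaklyRegular_pair t v k hc hvk (chartBase_F_two t v (Fin.succ k)) hFt
  have h2 := isWeaklyRegular_pair_swap _ _ (u'_mem_nonZeroDivisors t v hc k hvk)
    (G_mem_nonZeroDivisors t v hc k hvk) h1
  have h3 : RingTheory.Sequence.IsWeaklyRegular C[k]
      (List.ofFn (Fin.cons G[k] fun _ : Fin 1 => c[k])) :=
    isWeaklyRegular_pair_of_add_mul' _ _ _ h2
  exact isWeaklyRegular_pair_swap _ _ (G_mem_nonZeroDivisors t v hc k hvk)
    (c_mem_nonZeroDivisors t v hc k hvk) h3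

/-! ### The `v_k`-chart: the five-step letter tower -/

set_option maxHeartbeats 400000 in
include hc in
/-- **The `v_k`-chart of `Bl_{z₀}`: every blowing up of `Spec C_k` along
`Π C_k = (w⁵) · ∏_{s<5} (c, L₀⋯L_s)` is regular** — twist off `w⁵` (Stacks 080B) and run the letter
tower `isRegular_of_isBlowup_letterTower 5` with `(c; ℓ := w, o := G)` and letters `(w, G, w, w, G)`,
whose hypotheses `H''` are the lemmas above and brick 7.
[cite: StacksProject, Tag 080A] [cite: StacksProject, Tag 080B] [cite: Liu2002, Thm. 8.1.19 (a)] -/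
theorem isRegular_of_isBlowup_cubePi_succ (k : Fin 3) [IsRegularRing A]
    [IsDomain (A ⧸ Ideal.span (Set.range cc))] [IsRegularRing (A ⧸ Ideal.span (Set.range cc))]
    [IsDomain (A ⧸ Ideal.span {t})] (hdF : IsDomain (A ⧸ Ideal.span {t, v 0 * v 1 + v 2 ^ 2}))
    (hvk : v k ∉ Ideal.span {t}) (hFt : F ∉ Ideal.span {t})
    (hvkF : v k ∉ Ideal.span {t, v 0 * v 1 + v 2 ^ 2})
    (hreg1 : ∀ (P : Ideal (A ⧸ Ideal.span {t, F})) [P.IsPrime],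
      Ideal.Quotient.mk (Ideal.span {t, F}) (v k) ∉ P → IsRegularLocalRing (Localization.AtPrime P))
    {Y : Scheme.{u}} {ρ : Y ⟶ Spec (.of C[k])}
    (hρ : IsBlowup ρ (affineBlowup.idealSheaf ((cubePi).map (chartBase cc (Fin.succ k))))) :
    Scheme.IsRegular Y := by
  haveI : IsRegularRing C[k] := isRegularRing_blowupChart cc (Fin.succ k) hc
  haveI : IsDomain C[k] := strictExc_isDomain_chart t v k (strictExc_ne_zero t v k hvk)
  haveI := hdF
  -- `H''(C_k; c, w, G)`
  have hGn := G_notMem_sup t v hc k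
  have hcw := isWeaklyRegular_c_w t v hc k hvk
  have hcG := isWeaklyRegular_c_G t v hc k hvk hFt
  have hcl : IsQuasiRegular (Fin.cons c[k] (fun _ : Fin 1 => w[k]) : Fin 2 → C[k]) :=
    isQuasiRegular_of_isWeaklyRegular _ hcw
  have hco : IsQuasiRegular (Fin.cons c[k] (fun _ : Fin 1 => G[k]) : Fin 2 → C[k]) :=
    isQuasiRegular_of_isWeaklyRegular _ hcG
  have hdl := isDomain_quot_span_c_w t v hc k
  have hRl := isRegularRing_quot_span_c_w t v hc k
  have hdo : IsDomain (C[k] ⧸ Ideal.span {c[k], G[k]}) := by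
    rw [span_c_G t v k]
    exact strictHyp_isDomain_quot_pair t v k hc hvk (chartBase_F_two t v (Fin.succ k)) hGn hvkF
  have hRo : IsRegularRing (C[k] ⧸ Ideal.span {c[k], G[k]}) := by
    rw [span_c_G t v k]
    exact isRegularRing_quot_span_u'_G t v hc k hreg1
  have hlc : IsSMulRegular (C[k] ⧸ Ideal.span {c[k]}) w[k] :=
    ((isWeaklyRegular_pair_iff _ _).mp hcw).2
  have hoc : IsSMulRegular (C[k] ⧸ Ideal.span {c[k]}) G[k] :=
    ((isWeaklyRegular_pair_iff _ _).mp hcG).2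
  have hw0 : w[k] ≠ 0 := nonZeroDivisors.ne_zero (w_mem_nonZeroDivisors t v k)
  have hol : G[k] ∉ Ideal.span {c[k], w[k]} := G_notMem_span_c_w t v hc k
  have hlo : w[k] ∉ Ideal.span {c[k], G[k]} := by
    rw [span_c_G t v k]
    exact strictHyp_chartBase_notMem_pair t v k hc hvk (chartBase_F_two t v (Fin.succ k)) hGn hvkF
  have hw5 : w[k] ^ 5 ∈ nonZeroDivisors C[k] := pow_mem (w_mem_nonZeroDivisors t v k) 5
  rw [map_chartBase_cubePi t v (Fin.succ k)] at hρ
  exact CoreRungTower.isRegular_of_isBlowup_span_singleton_mul hw5 _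
    (fun Y' ρ' h' => isRegular_of_isBlowup_letterTower 5 c[k] w[k] G[k]
      (fun r => [w[k], G[k], w[k], w[k], G[k]].getD r 1) (cube_letters₂_spec w[k] G[k])
      hcl hco hdl hRl hdo hRo hlc hoc hw0 hol hlo h') hρ

/-! ### The `t`-chart and the assembly -/

omit [IsDomain A] in
include hc in
/-- **The `t`-chart of `Bl_{z₀}`: every blowing up of `Spec C₀` along `Π C₀ = (w)⁵` is regular**
(an isomorphism onto the regular chart). [cite: Liu2002, Thm. 8.1.19 (a) (affine charts)] -/
theorem isRegular_of_isBlowup_cubePi_zero [IsRegularRing A]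
    [IsRegularRing (A ⧸ Ideal.span (Set.range cc))]
    {Y : Scheme.{u}} {ρ : Y ⟶ Spec (.of (chartRing cc 0))}
    (hρ : IsBlowup ρ (affineBlowup.idealSheaf ((cubePi).map (chartBase cc 0)))) :
    Scheme.IsRegular Y := by
  haveI : IsRegularRing (chartRing cc 0) := isRegularRing_blowupChart cc 0 hc
  rw [map_chartBase_cubePi_zero, Ideal.span_singleton_pow] at hρ
  exact isRegular_of_isBlowup_idealSheaf_span_singleton_of_isRegularRing
    (pow_mem (reesChartBase_mem_nonZeroDivisors (cc 0)
      (Ideal.mem_span_range_self (f := cc) (x := 0))) 5) hρ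

include hc in
/-- **LEVEL TWO: every blowing up of `Spec A` along `Π · (t, v₀, v₁, v₂)` is regular** — blow up
the vertex `(t, v)` (chartwise assembly, Stacks 080A) and use the chart statements.
[cite: StacksProject, Tag 080A] [cite: Liu2002, Thm. 8.1.19 (a)] -/
theorem isRegular_of_isBlowup_cubePi_mul_span [IsRegularRing A]
    [IsDomain (A ⧸ Ideal.span (Set.range cc))] [IsRegularRing (A ⧸ Ideal.span (Set.range cc))]
    [IsDomain (A ⧸ Ideal.span {t})] (hdF : IsDomain (A ⧸ Ideal.span {t, v 0 * v 1 + v 2 ^ 2}))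
    (hv : ∀ k, v k ∉ Ideal.span {t}) (hFt : F ∉ Ideal.span {t})
    (hvF : ∀ k, v k ∉ Ideal.span {t, v 0 * v 1 + v 2 ^ 2})
    (hreg1 : ∀ (k : Fin 3) (P : Ideal (A ⧸ Ideal.span {t, F})) [P.IsPrime],
      Ideal.Quotient.mk (Ideal.span {t, F}) (v k) ∉ P → IsRegularLocalRing (Localization.AtPrime P))
    {Y : Scheme.{u}} {f : Y ⟶ Spec (.of A)}
    (hf : IsBlowup f (affineBlowup.idealSheaf ((cubePi) * Ideal.span {t, v 0, v 1, v 2}))) :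
    Scheme.IsRegular Y := by
  have e : (cubePi) * Ideal.span {t, v 0, v 1, v 2} = (cubePi) * Ideal.span (Set.range cc) :=
    congrArg _ (span_t_v_eq t v)
  rw [e] at hf
  exact isRegular_of_isBlowup_mul_of_charts cc _
    (fun j => Fin.cases
      (motive := fun j => ∀ (Y : Scheme.{u}) (ρ : Y ⟶ Spec (.of (chartRing cc j))),
        IsBlowup ρ (affineBlowup.idealSheaf ((cubePi).map (chartBase cc j))) →
          Scheme.IsRegular Y)
      (fun _ _ h => isRegular_of_isBlowup_cubePi_zero t v hc h)
      (fun k _ _ h => isRegular_of_isBlowup_cubePi_succ t v hc k hdF (hv k) hFt (hvF k) (hreg1 k) h) j)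
    hf

end LevelTwoRegular

end ConeRung

end Summit.ResolutionOfSingularities.ResolutionOfSingularities.Theorems

end
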